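import Literature.Geometry.Lorentzian.CoordNullRicciStructure
import Literature.Geometry.Lorentzian.CoordShrinkerRicciLaplacian
import Mathlib.Analysis.SpecialFunctions.Sqrt
import HarnessLib

/-!
# The null eigenvector field of a degenerate three-dimensional gradient soliton is parallel

For metric components `G` (the `MetricCoord` layer) in dimension three and a gradient Ricci
soliton `Ric + Hess f = λ G` on `V`: suppose that at every point of `V` the Ricci form has an
orthonormal eigenframe of type `(0, a, a)` whose null vector is the value of a smooth vector field
`v` (so `Ric(v, ·) ≡ 0`, `G(v,v) ≡ 1`, `Ric = (S/2)(G − v♭⊗v♭)`). Then **`v` is parallel**: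
`∇_X v = Dv(X) + Γ(X, v) = 0` at every point where `S ≠ 0`
(`IsMetricOn.fderiv_add_chrAt_null_eq_zero`).

This replaces, for gradient solitons, Hamilton's strong maximum principle ("the null space of
`Ric ≥ 0` is invariant under parallel translation") in the analysis of the degenerate case of the
classification of three-dimensional shrinking solitons; the proof is pure tensor calculus:

* differentiating `Ric(v,·) ≡ 0` and `G(v,v) ≡ 1`: `(∇_X Ric)(v, Z) = −Ric(∇_X v, Z)`,
  `G(∇_X v, v) = 0`;
* the soliton Codazzi identity `(∇_X Ric)(v,Z) − (∇_v Ric)(X,Z) = df(R(X,v)Z) = 0`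
  (`CoordShrinkerRicciLaplacian.IsMetricOn.cov₂At_ricAt_sub_of_soliton` and the nullity
  `R(·,v) = 0` of `CoordNullRicciStructure`);
* differentiating `Ric = (S/2)(G − v♭⊗v♭)` along `v` on `v^⊥`: `(∇_v Ric)(Y,Z) = ½ v(S) G(Y,Z)`
  for `Y, Z ⊥ v`, and `v(S) = 2 Ric(∇f, v) = 0` (`dS = 2Ric(∇f,·)`,
  `CoordShrinkerIdentities.IsMetricOn.fderiv_scalAt_of_soliton`);
* hence `Ric(∇_X v, ·) = 0` on `v^⊥` and `G(∇_X v, v) = 0`, i.e. `∇_X v = 0` as `S ≠ 0`.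

A smooth local unit null field exists near every point (`IsMetricOn.exists_smooth_null_field`:
`v = Pw/|Pw|` for the smooth kernel projector `P = 1 − (2/S)♯∘Ric`), so near every point of such a
soliton there is a PARALLEL unit null field (`IsMetricOn.exists_parallel_null_field`) — the local
splitting input of the degenerate case. Everything is proved; no definitions are introduced.

## References

* M. Eminenti, G. La Nave, C. Mantegazza, manuscripta math. 127 (2008), Prop. 2.1, §3. [EminentiLanaveMantegazza2008]
* R. S. Hamilton, J. Differential Geom. 24 (1986), Lemma 8.2 (the strong maximum principle it
  replaces). [Hamilton1986]
* P. Petersen, W. Wylie, Geom. Topol. 14 (2010), Lemma 2.1, §3 (rigidity). [PetersenWylie2010]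
-/

noncomputable section

set_option maxSynthPendingDepth 3

open Set Filter Module
open scoped Topology ContDiff

namespace Literature.Geometry.Lorentzian

namespace MetricCoord

variable {E : Type*} [NormedAddCommGroup E] [NormedSpace ℝ E] [FiniteDimensional ℝ E]
  [CompleteSpace E] {G : E → E →L[ℝ] E →L[ℝ] ℝ} {V : Set E} {y : E}

omit [FiniteDimensional ℝ E] [CompleteSpace E] in
/-- The derivative of a scalar function that is constant on a neighbourhood is zero. [folklore] -/
private theorem fderiv_apply_eq_zero_of_eqOn {φ : E → ℝ} {c : ℝ} (hV : V ∈ 𝓝 y)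
    (h : ∀ z ∈ V, φ z = c) (X : E) : fderiv ℝ φ y X = 0 := by
  have heq : φ =ᶠ[𝓝 y] fun _ ↦ c := Filter.mem_of_superset hV fun z hz ↦ h z hz
  rw [heq.fderiv_eq]
  simp

/-- **The null eigenvector field of a degenerate three-dimensional gradient soliton is parallel.**
On `V` let `Ric + Hess f = λG` and let `v` be a smooth field such that at every `z ∈ V` there is a
`G_z`-orthonormal eigenframe `(v(z), e₁, e₂)` of `Ric_z` with eigenvalues `(0, a, a)`. Then at
every `y ∈ V` with `S(y) ≠ 0`: `Dv(y)(X) + Γ_y(X, v(y)) = 0` for all `X` (`∇v = 0`).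
[cite: EminentiLanaveMantegazza2008, Prop. 2.1, §3] [cite: Hamilton1986, Lemma 8.2] -/
theorem IsMetricOn.fderiv_add_chrAt_null_eq_zero (hG : IsMetricOn G V) (hy : y ∈ V)
    {f : E → ℝ} {lam : ℝ} (hf : ContDiffOn ℝ ∞ f V)
    (hsol : ∀ z ∈ V, ∀ u w, ricAt G z u w + hessAt G f z u w = lam * G z u w)
    {v : E → E} (hv : ContDiffOn ℝ ∞ v V)
    (hframe : ∀ z ∈ V, ∃ (e : Basis (Fin 3) ℝ E) (a : ℝ), e 0 = v z ∧
      (∀ i j, G z (e i) (e j) = if i = j then 1 else 0) ∧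
      ∀ i w, ricAt G z (e i) w = (if i = 0 then 0 else a) * G z (e i) w)
    (hS : scalAt G y ≠ 0) (X : E) :
    fderiv ℝ v y X + chrAt G y X (v y) = 0 := by
  have hi := hG.isInvertible y hy
  have hs := hG.symm y hy
  have hVn : V ∈ 𝓝 y := hG.mem_nhds hy
  -- (0) pointwise structure on `V`
  have hnull : ∀ z ∈ V, ∀ Z, ricAt G z (v z) Z = 0 := by
    intro z hz Z
    obtain ⟨e, a, he0, he, hμ⟩ := hframe z hz
    rw [← he0, hμ]; simp
  have hunit : ∀ z ∈ V, G z (v z) (v z) = 1 := by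
    intro z hz
    obtain ⟨e, a, he0, he, -⟩ := hframe z hz
    rw [← he0, he]; simp
  have hstruct : ∀ z ∈ V, ∀ Y Z, ricAt G z Y Z =
      scalAt G z / 2 * (G z Y Z - G z (v z) Y * G z (v z) Z) := by
    intro z hz Y Z
    obtain ⟨e, a, he0, he, hμ⟩ := hframe z hz
    have hSz : scalAt G z = 2 * a := by
      rw [scalAt_eq_sum_of_eigenframe e he hμ (hG.isInvertible z hz), Fin.sum_univ_three]
      simp only [Fin.isValue, if_true, show (1 : Fin 3) ≠ 0 from by decide,
        show (2 : Fin 3) ≠ 0 from by decide, if_false]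
      ring
    rw [ricAt_eq_of_null_eigenframe e he hμ (hG.symm z hz) Y Z, he0, hSz]
    ring
  obtain ⟨e, a, he0, he, hμ⟩ := hframe y hy
  set aY : ℝ := scalAt G y / 2 with haY
  have haY0 : aY ≠ 0 := by rw [haY]; exact div_ne_zero hS two_ne_zero
  have hRic : ∀ W Z, ricAt G y W Z = aY * (G y W Z - G y (v y) W * G y (v y) Z) :=
    fun W Z ↦ hstruct y hy W Z
  -- differentiability at `y`
  have hGd : HasFDerivAt G (fderiv ℝ G y) y :=
    ((hG.contDiffOn.contDiffAt hVn).differentiableAt (by simp)).hasFDerivAt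
  have hRd : HasFDerivAt (ricAt G) (fderiv ℝ (ricAt G) y) y :=
    ((hG.contDiffOn_ricAt.contDiffAt hVn).differentiableAt (by simp)).hasFDerivAt
  have hSd : HasFDerivAt (scalAt G) (fderiv ℝ (scalAt G) y) y :=
    ((hG.contDiffOn_scalAt.contDiffAt hVn).differentiableAt (by simp)).hasFDerivAt
  have hvd : HasFDerivAt v (fderiv ℝ v y) y :=
    ((hv.contDiffAt hVn).differentiableAt (by simp)).hasFDerivAt
  -- the covariant derivative of `v`
  set N : E → E := fun X ↦ fderiv ℝ v y X + chrAt G y X (v y) with hN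
  have hNlin : ∀ (c : ℝ) (X₁ X₂ : E), N (X₁ + c • X₂) = N X₁ + c • N X₂ := fun c X₁ X₂ ↦ by
    simp only [hN, map_add, map_smul, _root_.add_apply, _root_.smul_apply, smul_add]
    abel
  -- (S3) `G(∇_X v, v) = 0`, from `G(v,v) ≡ 1`
  have hNv : ∀ X, G y (N X) (v y) = 0 := by
    intro X
    have hφ : HasFDerivAt (fun z ↦ G z (v z) (v z))
        (((G y) (v y)).comp (fderiv ℝ v y) +
          (((G y).comp (fderiv ℝ v y)) + (fderiv ℝ G y).flip (v y)).flip (v y)) y :=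
      (hGd.clm_apply hvd).clm_apply hvd
    have h0 := fderiv_apply_eq_zero_of_eqOn hVn hunit X
    rw [hφ.fderiv] at h0
    simp only [_root_.add_apply, ContinuousLinearMap.comp_apply,
      ContinuousLinearMap.flip_apply, hG.fderiv_eq_chrAt hy] at h0
    -- `h0 : G(v, Dv X) + (G(Dv X, v) + (G(Γ(X,v),v) + G(v,Γ(X,v)))) = 0`
    simp only [hN, map_add, _root_.add_apply]
    rw [hs (v y) (fderiv ℝ v y X), hs (v y) (chrAt G y X (v y))] at h0
    linarith
  -- (S1) `(∇_X Ric)(v, Z) = −Ric(∇_X v, Z)`, from `Ric(v,·) ≡ 0`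
  have hcovV : ∀ X Z, cov₂At G (ricAt G) y X (v y) Z = -ricAt G y (N X) Z := by
    intro X Z
    have hψ : HasFDerivAt (fun z ↦ ricAt G z (v z) Z)
        ((((ricAt G y).comp (fderiv ℝ v y)) + (fderiv ℝ (ricAt G) y).flip (v y)).flip Z) y :=
      (hRd.clm_apply hvd).clm_apply (hasFDerivAt_const Z y) |>.congr_fderiv (by
        ext W; simp)
    have h0 := fderiv_apply_eq_zero_of_eqOn hVn (fun z hz ↦ hnull z hz Z) X
    rw [hψ.fderiv] at h0
    simp only [_root_.add_apply, ContinuousLinearMap.comp_apply,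
      ContinuousLinearMap.flip_apply] at h0
    -- `h0 : Ric(Dv X, Z) + D_X Ric (v) Z = 0`
    rw [cov₂At_apply, hnull y hy]
    simp only [hN, map_add, _root_.add_apply]
    linarith
  -- (S4) the Codazzi identity with the nullity `R(X, v) = 0`
  have hμ' : ∀ i w, ricAt G y (e i) w = (if i = 0 then 0 else a) * G y (e i) w := hμ
  have hCod : ∀ X Z, cov₂At G (ricAt G) y (v y) X Z = cov₂At G (ricAt G) y X (v y) Z := by
    intro X Z
    have h := hG.cov₂At_ricAt_sub_of_soliton hy hf hsol X (v y) Z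
    rw [← he0, hG.riemAt_null_eq_zero e he hμ' hy X] at h
    simp only [_root_.zero_apply, map_zero, sub_eq_zero] at h
    rw [← he0]
    exact h.symm
  -- (S7') `v(S) = 2 Ric(∇f, v) = 0`
  have hvS : fderiv ℝ (scalAt G) y (v y) = 0 := by
    rw [hG.fderiv_scalAt_of_soliton hy hf hsol, hG.ricAt_comm hy, hnull y hy, mul_zero]
  -- (S5) `(∇_v Ric)(Y, Z) = ½ v(S) G(Y,Z) = 0` for `Y, Z ⊥ v`
  have hcovvv : ∀ Y Z, G y (v y) Y = 0 → G y (v y) Z = 0 →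
      cov₂At G (ricAt G) y (v y) Y Z = 0 := by
    intro Y Z hY hZ
    -- the scalar functions
    have hr : HasFDerivAt (fun z ↦ ricAt G z Y Z) ((fderiv ℝ (ricAt G) y).flip Y |>.flip Z) y :=
      ((hRd.clm_apply (hasFDerivAt_const Y y)).clm_apply (hasFDerivAt_const Z y)).congr_fderiv
        (by ext W; simp)
    have hg : HasFDerivAt (fun z ↦ G z Y Z) ((fderiv ℝ G y).flip Y |>.flip Z) y :=
      ((hGd.clm_apply (hasFDerivAt_const Y y)).clm_apply (hasFDerivAt_const Z y)).congr_fderiv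
        (by ext W; simp)
    have hp : HasFDerivAt (fun z ↦ G z (v z) Y)
        ((((G y).comp (fderiv ℝ v y)) + (fderiv ℝ G y).flip (v y)).flip Y) y :=
      ((hGd.clm_apply hvd).clm_apply (hasFDerivAt_const Y y)).congr_fderiv (by ext W; simp)
    have hq : HasFDerivAt (fun z ↦ G z (v z) Z)
        ((((G y).comp (fderiv ℝ v y)) + (fderiv ℝ G y).flip (v y)).flip Z) y :=
      ((hGd.clm_apply hvd).clm_apply (hasFDerivAt_const Z y)).congr_fderiv (by ext W; simp)
    -- `χ = r − (s/2)(g − p q) ≡ 0`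
    have hχ := (hr.sub ((hSd.mul (hg.sub (hp.mul hq))).const_mul (1 / 2 : ℝ)))
    have h0 : fderiv ℝ (fun z ↦ ricAt G z Y Z - 1 / 2 * (scalAt G z * (G z Y Z - G z (v z) Y * G z (v z) Z)))
        y (v y) = 0 :=
      fderiv_apply_eq_zero_of_eqOn (c := 0) hVn (fun z hz ↦ by rw [hstruct z hz Y Z]; ring) (v y)
    have hχ' : HasFDerivAt
        (fun z ↦ ricAt G z Y Z - 1 / 2 * (scalAt G z * (G z Y Z - G z (v z) Y * G z (v z) Z))) _ y :=
      hχ.congr_of_eventuallyEq (Filter.Eventually.of_forall fun z ↦ by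
        simp only [Pi.sub_apply, Pi.mul_apply])
    rw [hχ'.fderiv] at h0
    simp only [_root_.sub_apply, _root_.add_apply,
      _root_.smul_apply, ContinuousLinearMap.comp_apply,
      ContinuousLinearMap.flip_apply, smul_eq_mul, hY, hZ, mul_zero, zero_mul, sub_zero,
      add_zero, hvS, Pi.sub_apply, Pi.mul_apply] at h0
    -- `h0 : D_v Ric Y Z − ½ S · D_v G Y Z = 0`
    rw [cov₂At_apply, hRic (chrAt G y (v y) Y) Z, hRic Y (chrAt G y (v y) Z), hY, hZ]
    rw [hG.fderiv_eq_chrAt hy] at h0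
    rw [haY]
    linarith
  -- (E1) `(∇_X Ric)(v,Z) = −a G(∇_X v, Z)`
  have hE1 : ∀ X Z, cov₂At G (ricAt G) y X (v y) Z = -(aY * G y (N X) Z) := by
    intro X Z
    rw [hcovV, hRic, hs (v y) (N X), hNv]
    ring
  have hsy := fun W Y Z ↦ hG.cov₂At_ricAt_symm hy W Y Z
  -- orthogonal projection onto `v^⊥`
  have hperp : ∀ Z, G y (v y) (Z - G y (v y) Z • v y) = 0 := fun Z ↦ by
    rw [map_sub, map_smul, smul_eq_mul, hunit y hy, mul_one, sub_self]
  -- `G(∇_X v, Z) = 0` for `X, Z ⊥ v`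
  have hperpperp : ∀ X Z, G y (v y) X = 0 → G y (v y) Z = 0 → G y (N X) Z = 0 := by
    intro X Z hX hZ
    have h1 := hE1 X Z
    rw [← hCod, hcovvv X Z hX hZ] at h1
    have : aY * G y (N X) Z = 0 := by linarith
    exact (mul_eq_zero.mp this).resolve_left haY0
  -- `G(∇_v v, Z) = 0` for `Z ⊥ v`
  have hvperp : ∀ Z, G y (v y) Z = 0 → G y (N (v y)) Z = 0 := by
    intro Z hZ
    have h1 := hE1 (v y) Z
    rw [hsy, hCod Z (v y), hE1 Z (v y), hNv] at h1
    have : aY * G y (N (v y)) Z = 0 := by linarith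
    exact (mul_eq_zero.mp this).resolve_left haY0
  -- `G(∇_X v, Z) = 0` for `Z ⊥ v` and all `X`
  have hallperp : ∀ X Z, G y (v y) Z = 0 → G y (N X) Z = 0 := by
    intro X Z hZ
    have hdec : X = (X - G y (v y) X • v y) + G y (v y) X • v y := by abel
    rw [hdec, hNlin, map_add, map_smul, _root_.add_apply,
      _root_.smul_apply, smul_eq_mul, hperpperp _ Z (hperp X) hZ, hvperp Z hZ]
    ring
  -- all pairings vanish
  have hall : ∀ Z, G y (N X) Z = 0 := by
    intro Z
    have hdec : Z = (Z - G y (v y) Z • v y) + G y (v y) Z • v y := by abel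
    rw [hdec, map_add, map_smul, smul_eq_mul, hallperp X _ (hperp Z), hNv]
    ring
  have h3 : G y (N X) = 0 := by ext Z; rw [hall]; rfl
  exact hi.injective (h3.trans (map_zero (G y)).symm)

omit [FiniteDimensional ℝ E] [CompleteSpace E] in
/-- Restriction of metric components to an open subset. [folklore] -/
theorem IsMetricOn.mono (hG : IsMetricOn G V) {U : Set E} (hU : IsOpen U) (hUV : U ⊆ V) :
    IsMetricOn G U :=
  ⟨hU, hG.contDiffOn.mono hUV, fun x hx ↦ hG.symm x (hUV hx), fun x hx ↦ hG.isInvertible x (hUV hx)⟩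

omit [FiniteDimensional ℝ E] [CompleteSpace E] in
/-- `♯(G(u, ·)) = u`. [cite: ONeill1983, Ch. 3, p. 60] -/
theorem sharpAt_metric_apply (hx : (G y).IsInvertible) (hs : ∀ v w, G y v w = G y w v) (u : E) :
    sharpAt G y (G y u) = u := by
  apply hx.injective
  ext w
  rw [apply_sharpAt_apply hx, hs]

/-- **A smooth local unit null field.** If at every point of `V` the Ricci form of `G` (positive
definite) has an orthonormal eigenframe of type `(0, a, a)` with `a ≠ 0`, then near every point
there is a smooth field `v` whose value at each point is the null vector of such a frame
(`v = Pw/|Pw|` for the smooth kernel projector `P = 1 − (2/S) ♯∘Ric` and a fixed `w`).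
[cite: ONeill1983, Ch. 3, Lemma 3.52] [cite: PetersenWylie2010, §3] -/
theorem IsMetricOn.exists_smooth_null_field (hG : IsMetricOn G V) (hy : y ∈ V)
    (hpos : ∀ z ∈ V, ∀ w : E, w ≠ 0 → 0 < G z w w)
    (hdeg : ∀ z ∈ V, ∃ (e : Basis (Fin 3) ℝ E) (a : ℝ), a ≠ 0 ∧
      (∀ i j, G z (e i) (e j) = if i = j then 1 else 0) ∧
      ∀ i w, ricAt G z (e i) w = (if i = 0 then 0 else a) * G z (e i) w) :
    ∃ U : Set E, IsOpen U ∧ y ∈ U ∧ U ⊆ V ∧ ∃ v : E → E, ContDiffOn ℝ ∞ v U ∧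
      ∀ z ∈ U, ∃ (e : Basis (Fin 3) ℝ E) (a : ℝ), e 0 = v z ∧
        (∀ i j, G z (e i) (e j) = if i = j then 1 else 0) ∧
        ∀ i w, ricAt G z (e i) w = (if i = 0 then 0 else a) * G z (e i) w := by
  classical
  obtain ⟨e, a, ha, he, hμ⟩ := hdeg y hy
  set w : E := e 0 with hw
  -- the kernel component `q(z) = P_z w = w − (2/S(z)) ♯Ric_z(w)`
  set q : E → E := fun z ↦ w - (2 / scalAt G z) • sharpAt G z (ricAt G z w) with hq
  -- pointwise: `q(z) = G_z(w, ẽ₀) ẽ₀` in any frame of type `(0,ã,ã)` at `z`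
  have hqz : ∀ z ∈ V, ∀ (e' : Basis (Fin 3) ℝ E) (a' : ℝ), a' ≠ 0 →
      (∀ i j, G z (e' i) (e' j) = if i = j then 1 else 0) →
      (∀ i w, ricAt G z (e' i) w = (if i = 0 then 0 else a') * G z (e' i) w) →
      q z = G z w (e' 0) • e' 0 := by
    intro z hz e' a' ha' he' hμ'
    have hiz := hG.isInvertible z hz
    have hsz := hG.symm z hz
    have hSz : scalAt G z = 2 * a' := by
      rw [scalAt_eq_sum_of_eigenframe e' he' hμ' hiz, Fin.sum_univ_three]
      simp only [Fin.isValue, if_true, show (1 : Fin 3) ≠ 0 from by decide,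
        show (2 : Fin 3) ≠ 0 from by decide, if_false]
      ring
    have hRe : ∀ i, ricAt G z (e' i) = (if i = 0 then 0 else a') • G z (e' i) := fun i ↦ by
      ext u; rw [_root_.smul_apply, hμ', smul_eq_mul]
    have hsh : ∀ i, sharpAt G z (ricAt G z (e' i)) = (if i = 0 then 0 else a') • e' i := fun i ↦ by
      rw [hRe, map_smul, sharpAt_metric_apply hiz hsz]
    have hwexp := sum_apply_smul_of_orthonormal e' he' w
    have hS0 : scalAt G z ≠ 0 := by rw [hSz]; exact mul_ne_zero two_ne_zero ha'
    apply smul_right_injective E hS0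
    simp only [hq]
    rw [smul_sub, smul_smul, mul_div_cancel₀ _ hS0]
    conv_lhs => rw [← hwexp]
    rw [Fin.sum_univ_three]
    simp only [map_add, map_smul, hsh, Fin.isValue, hSz]
    simp only [show (1 : Fin 3) ≠ 0 from by decide, show (2 : Fin 3) ≠ 0 from by decide,
      if_true, if_false, zero_smul, smul_zero, zero_add]
    module
  -- `q(y) = w ≠ 0`
  have hqy : q y = w := by
    rw [hqz y hy e a ha he hμ, hw, he]; simp
  have hw0 : w ≠ 0 := e.ne_zero 0
  -- smoothness of `q` on `V`
  have hSne : ∀ z ∈ V, scalAt G z ≠ 0 := by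
    intro z hz
    obtain ⟨e', a', ha', he', hμ'⟩ := hdeg z hz
    rw [scalAt_eq_sum_of_eigenframe e' he' hμ' (hG.isInvertible z hz), Fin.sum_univ_three]
    simp only [Fin.isValue, if_true, show (1 : Fin 3) ≠ 0 from by decide,
      show (2 : Fin 3) ≠ 0 from by decide, if_false]
    intro h; apply ha'; linarith
  have hqs : ContDiffOn ℝ ∞ q V := by
    simp only [hq]
    refine contDiffOn_const.sub (ContDiffOn.smul (contDiffOn_const.div hG.contDiffOn_scalAt hSne)
      (hG.contDiffOn_sharpAt.clm_apply (hG.contDiffOn_ricAt.clm_apply contDiffOn_const)))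
  -- the open set where `q ≠ 0`
  set U : Set E := V ∩ q ⁻¹' {0}ᶜ with hU
  have hUo : IsOpen U := hqs.continuousOn.isOpen_inter_preimage hG.isOpen isOpen_compl_singleton
  have hyU : y ∈ U := ⟨hy, by simp [hqy, hw0]⟩
  have hUV : U ⊆ V := Set.inter_subset_left
  -- the unit field
  set v : E → E := fun z ↦ (Real.sqrt (G z (q z) (q z)))⁻¹ • q z with hv
  have hGq : ∀ z ∈ U, 0 < G z (q z) (q z) := fun z hz ↦ hpos z hz.1 _ hz.2
  have hvs : ContDiffOn ℝ ∞ v U := by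
    have h1 : ContDiffOn ℝ ∞ (fun z ↦ G z (q z) (q z)) U :=
      ((hG.contDiffOn.mono hUV).clm_apply (hqs.mono hUV)).clm_apply (hqs.mono hUV)
    have h2 : ContDiffOn ℝ ∞ (fun z ↦ (Real.sqrt (G z (q z) (q z)))⁻¹) U :=
      (h1.sqrt fun z hz ↦ (hGq z hz).ne').inv fun z hz ↦ (Real.sqrt_pos.mpr (hGq z hz)).ne'
    exact h2.smul (hqs.mono hUV)
  refine ⟨U, hUo, hyU, hUV, v, hvs, fun z hz ↦ ?_⟩
  -- the frame at `z ∈ U`: replace `ẽ₀` by `v(z) = ±ẽ₀`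
  obtain ⟨e', a', ha', he', hμ'⟩ := hdeg z hz.1
  have hqe := hqz z hz.1 e' a' ha' he' hμ'
  set c : ℝ := G z w (e' 0) with hc
  have hc0 : c ≠ 0 := by
    intro h0; apply hz.2
    simp [hqe, h0]
  have hGqq : G z (q z) (q z) = c ^ 2 := by
    rw [hqe]
    simp only [map_smul, _root_.smul_apply, smul_eq_mul, he']
    simp [sq]
  have hvz : v z = (c / |c|) • e' 0 := by
    simp only [hv]
    rw [hGqq, Real.sqrt_sq_eq_abs, hqe, smul_smul, div_eq_inv_mul]
  set ε : ℝ := c / |c| with hε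
  have hε2 : ε * ε = 1 := by
    rw [hε, div_mul_div_comm, ← sq, ← sq, sq_abs, div_self (pow_ne_zero 2 hc0)]
  -- the new frame
  set fr : Fin 3 → E := fun i ↦ if i = 0 then v z else e' i with hfr
  have hfr0 : fr 0 = v z := by simp [hfr]
  have hfrS : ∀ i, i ≠ 0 → fr i = e' i := fun i hi ↦ by simp [hfr, hi]
  have hfrON : ∀ i j, G z (fr i) (fr j) = if i = j then 1 else 0 := by
    intro i j
    by_cases hi : i = 0 <;> by_cases hj : j = 0
    · subst hi; subst hj
      rw [hfr0, hvz]
      simp only [map_smul, _root_.smul_apply, smul_eq_mul, he']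
      simp only [if_true, mul_one]
      exact hε2
    · subst hi
      rw [hfr0, hfrS j hj, hvz]
      simp only [map_smul, _root_.smul_apply, smul_eq_mul, he', if_neg (Ne.symm hj), mul_zero]
    · subst hj
      rw [hfr0, hfrS i hi, hvz]
      simp only [map_smul, smul_eq_mul, he', if_neg hi, mul_zero]
    · rw [hfrS i hi, hfrS j hj, he']
  have hfrEig : ∀ i u, ricAt G z (fr i) u = (if i = 0 then 0 else a') * G z (fr i) u := by
    intro i u
    by_cases hi : i = 0
    · subst hi
      rw [hfr0, hvz, map_smul, _root_.smul_apply, smul_eq_mul, hμ']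
      simp
    · rw [hfrS i hi, hμ', if_neg hi]
  -- it is a basis
  have hli : LinearIndependent ℝ fr := by
    rw [Fintype.linearIndependent_iff]
    intro cf hcf i
    have h := congrArg (fun u ↦ G z u (fr i)) hcf
    simp only [map_sum, map_smul, FunLike.coe_sum, Finset.sum_apply, FunLike.coe_smul,
      Pi.smul_apply, smul_eq_mul, hfrON, mul_ite, mul_one, mul_zero, Finset.sum_ite_eq',
      Finset.mem_univ, if_true, map_zero, _root_.zero_apply] at h
    exact h
  have hcard : Fintype.card (Fin 3) = finrank ℝ E := (Module.finrank_eq_card_basis e).symm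
  have hspan : ⊤ ≤ Submodule.span ℝ (Set.range fr) := (hli.span_eq_top_of_card_eq_finrank' hcard).ge
  refine ⟨Basis.mk hli hspan, a', ?_, fun i j ↦ ?_, fun i u ↦ ?_⟩
  · rw [Basis.coe_mk, hfr0]
  · rw [Basis.coe_mk]; exact hfrON i j
  · rw [Basis.coe_mk]; exact hfrEig i u

/-- **Local parallel unit null field of a degenerate three-dimensional gradient soliton**
(`exists_smooth_null_field` + `fderiv_add_chrAt_null_eq_zero`): if `Ric + Hess f = λG` on `V`,
`G` is positive definite, and at every point of `V` the Ricci form has an orthonormal eigenframe of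
type `(0, a, a)` with `a ≠ 0`, then near every point there is a smooth unit field `v` of null
vectors of `Ric` with `∇v = 0`. [cite: EminentiLanaveMantegazza2008, Prop. 2.1, §3]
[cite: Hamilton1986, Lemma 8.2] [cite: PetersenWylie2010, §3] -/
theorem IsMetricOn.exists_parallel_null_field (hG : IsMetricOn G V) (hy : y ∈ V)
    (hpos : ∀ z ∈ V, ∀ w : E, w ≠ 0 → 0 < G z w w)
    {f : E → ℝ} {lam : ℝ} (hf : ContDiffOn ℝ ∞ f V)
    (hsol : ∀ z ∈ V, ∀ u w, ricAt G z u w + hessAt G f z u w = lam * G z u w)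
    (hdeg : ∀ z ∈ V, ∃ (e : Basis (Fin 3) ℝ E) (a : ℝ), a ≠ 0 ∧
      (∀ i j, G z (e i) (e j) = if i = j then 1 else 0) ∧
      ∀ i w, ricAt G z (e i) w = (if i = 0 then 0 else a) * G z (e i) w) :
    ∃ U : Set E, IsOpen U ∧ y ∈ U ∧ U ⊆ V ∧ ∃ v : E → E, ContDiffOn ℝ ∞ v U ∧
      (∀ z ∈ U, G z (v z) (v z) = 1 ∧ ∀ Z, ricAt G z (v z) Z = 0) ∧
      ∀ z ∈ U, ∀ X, fderiv ℝ v z X + chrAt G z X (v z) = 0 := by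
  obtain ⟨U, hUo, hyU, hUV, v, hvs, hfrU⟩ := hG.exists_smooth_null_field hy hpos hdeg
  have hGU : IsMetricOn G U := hG.mono hUo hUV
  refine ⟨U, hUo, hyU, hUV, v, hvs, fun z hz ↦ ?_, fun z hz X ↦ ?_⟩
  · obtain ⟨e, a, he0, he, hμ⟩ := hfrU z hz
    refine ⟨by rw [← he0, he]; simp, fun Z ↦ by rw [← he0, hμ]; simp⟩
  · have hSz : scalAt G z ≠ 0 := by
      obtain ⟨e, a, ha, he, hμ⟩ := hdeg z (hUV hz)
      rw [scalAt_eq_sum_of_eigenframe e he hμ (hG.isInvertible z (hUV hz)), Fin.sum_univ_three]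
      simp only [Fin.isValue, if_true, show (1 : Fin 3) ≠ 0 from by decide,
        show (2 : Fin 3) ≠ 0 from by decide, if_false]
      intro h; apply ha; linarith
    exact hGU.fderiv_add_chrAt_null_eq_zero hz (hf.mono hUV) (fun z' hz' ↦ hsol z' (hUV hz')) hvs
      hfrU hSz X

end MetricCoord

end Literature.Geometry.Lorentzian

end
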